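import Literature.NumberTheory.GaloisRepresentations.IdeleClassBarPresentationBoundary
import Literature.NumberTheory.GaloisRepresentations.GalLayerSystemSESLayers
import HarnessLib

/-!
# The E-side of (R4) in the IDÈLE layer: `inv_K(Inf_E c ∘ ∂_{C̄}(f ≫ (J̄ → C̄))) = inv_{E/K}((class map)_* iso^J_E ((f^{U_E})_* (δ c)))`
# (Tate C–F VII §11.2 (bis); Milne ADT I Thm. 4.10, proof)

Topic `NumberTheory/GaloisRepresentations`; namespace `Literature.NumberTheory.GaloisRepresentations.FreePresentation` (and one
lemma in `IdeleClassBar`).  Sequel to door-c4 g17's `IdeleClassBarPresentationBoundary.lean`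
(`classBarInv_inflG_comp_boundary_presentation`) and door-c5 g16's `GalLayerSystemSESLayers.lean`
(`functor_map_ideleToClass_comp_layerCohomologyIso`: under the layer cohomology isomorphisms the map induced by `J̄ → C̄` on
door-c4's layers IS `H²(Gal(E/K), classRepHom)`; `classData_layerCohomologyIso`, `rfl`).  Theorems only (no definition, no named
fact, no instance, no notation, no `sorry`).

THE POINT.  The previous file left the E-side value as `inv_{E/K}(iso^C_E ((f ≫ g)^{U_E}_* (δ c)))` with `iso^C_E` the layer iso
of `C̄`.  Splitting `(f ≫ g)^{U_E}_* = g^{U_E}_* ∘ f^{U_E}_*` and moving the iso across `g = (ideleToClass K).limitHom`: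

* `layerCohomologyIso_hom_map_comp_ideleToClass` — `iso^C_E ((φ ≫ g)^{U_E}_* z) = (classRepHom)_* (iso^J_E (φ^{U_E}_* z))` for any
  `φ : X ⟶ J̄` and `z ∈ Hⁿ(Γ_K ⧸ U_E, X^{U_E})` (`iso^J_E = (ideleData K).layerCohomologyIso E n : Hⁿ(Γ_K ⧸ U_E, J̄^{U_E}) ≅ Hⁿ(Gal(E/K), J_E)`);
* **`classBarInv_inflG_comp_boundary_presentation_idele`** —
  `classBarInv K (Inf_E c ∘ ∂_{C̄}(f ≫ g)) = classInvAll K E ((classRepHom)_* (iso^J_E ((f^{U_E})_* (δ_{S^{U_E}} c))))`,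
  i.e. the value is `inv_{E/K}` OF THE IMAGE OF AN IDÈLE COHOMOLOGY CLASS `β := iso^J_E ((f^{U_E})_* δ c) ∈ H²(Gal(E/K), J_E)` —
  the input of door-c5's F7-dict (i) `inv_{E/K} ∘ (class map)_* = Σ_v inv_v` (Tate VII §11.2 (bis));
* `exists_layer_classBarInv_comp_boundary_eq_idele` — the same packaged with `ŷ = Inf_E c` for EVERY `ŷ`.

HONEST FRAMING: bookkeeping; no arithmetic beyond the definitions, no case of BSD or of Poitou–Tate.  Route A (R4, E-side) of crux
`AnticycControlAdditiveK` (item 19295, cell bsd-schneider), seat door-c4 gen 17.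

## References
* J. W. S. Cassels, A. Fröhlich (eds.), *Algebraic Number Theory* (1967), Ch. VII (J. Tate) §11.2 (bis). [CasselsFrohlichANT1967]
* J. S. Milne, *Arithmetic Duality Theorems* (2nd ed. 2006), I §4, proof of Theorem 4.10 (p. 58). [MilneADT2006]
-/

noncomputable section

open NumberField CategoryTheory CategoryTheory.Abelian groupCohomology
open Field (absoluteGaloisGroup)
open Literature.Algebra.Homology Literature.Algebra.Homology.DiscreteRep
open Literature.NumberTheory.Automorphic
open scoped Classical

namespace Literature.NumberTheory.GaloisRepresentations

namespace IdeleClassBar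

variable {K : Type} [Field K] [NumberField K]

/-- **`iso^C_E ((φ ≫ g)^{U_E}_* z) = (classRepHom)_* (iso^J_E (φ^{U_E}_* z))`** for `g : J̄ → C̄` the class map
(`(ideleClassLimitShortComplex K).g = (ideleToClass K).limitHom`), any `φ : X ⟶ J̄` and `z ∈ Hⁿ(Γ_K ⧸ U_E, X^{U_E})`
(functoriality `map_id_comp` and door-c5's `functor_map_ideleToClass_comp_layerCohomologyIso`, `classData_layerCohomologyIso`).
[cite: CasselsFrohlichANT1967, Ch. VII §11.2 (bis)] -/
theorem layerCohomologyIso_hom_map_comp_ideleToClass (E : GalLayer K) {X : DiscreteRepCat ℤ (absoluteGaloisGroup K)}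
    (φ : X ⟶ (ideleClassLimitShortComplex K).X₂) (n : ℕ)
    (z : groupCohomology ((invariantsQuotFunctor ℤ (E.openNormalSubgroup : Subgroup (absoluteGaloisGroup K))).obj X) n) :
    (layerCohomologyIso E n).hom ((groupCohomology.map (MonoidHom.id _)
        ((invariantsQuotFunctor ℤ (E.openNormalSubgroup : Subgroup (absoluteGaloisGroup K))).map
          (φ ≫ (ideleClassLimitShortComplex K).g)) n).hom z) =
      (haveI := E.numberField;
        (groupCohomology.map (MonoidHom.id _) (IdeleClassGroup.classRepHom K E.1) n).hom
          (((ideleData K).layerCohomologyIso E n).hom ((groupCohomology.map (MonoidHom.id _)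
            ((invariantsQuotFunctor ℤ (E.openNormalSubgroup : Subgroup (absoluteGaloisGroup K))).map φ) n).hom z))) := by
  haveI := E.numberField
  -- functoriality of door-c4's layer functor and of `Hⁿ`
  have e1 : (groupCohomology.map (MonoidHom.id _)
        ((invariantsQuotFunctor ℤ (E.openNormalSubgroup : Subgroup (absoluteGaloisGroup K))).map
          (φ ≫ (ideleClassLimitShortComplex K).g)) n).hom z =
      (groupCohomology.map (MonoidHom.id _)
        ((invariantsQuotFunctor ℤ (E.openNormalSubgroup : Subgroup (absoluteGaloisGroup K))).map
          (ideleClassLimitShortComplex K).g) n).hom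
        ((groupCohomology.map (MonoidHom.id _)
          ((invariantsQuotFunctor ℤ (E.openNormalSubgroup : Subgroup (absoluteGaloisGroup K))).map φ) n).hom z) := by
    rw [Functor.map_comp, groupCohomology.map_id_comp, ModuleCat.comp_apply]
  -- door-c5's square `Hⁿ((J̄ → C̄)^{U_E}) ≫ iso^C_E = iso^J_E ≫ Hⁿ(classRepHom)`, elementwise (`T.g = (ideleToClass K).limitHom`,
  -- `(classData K).layerCohomologyIso = layerCohomologyIso`, both definitionally)
  have e2 : ∀ w : groupCohomology ((invariantsQuotFunctor ℤ (E.openNormalSubgroup : Subgroup (absoluteGaloisGroup K))).obj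
      (ideleClassLimitShortComplex K).X₂) n,
      (layerCohomologyIso E n).hom ((groupCohomology.map (MonoidHom.id _)
        ((invariantsQuotFunctor ℤ (E.openNormalSubgroup : Subgroup (absoluteGaloisGroup K))).map
          (ideleClassLimitShortComplex K).g) n).hom w) =
      (groupCohomology.map (MonoidHom.id _) (IdeleClassGroup.classRepHom K E.1) n).hom
        (((ideleData K).layerCohomologyIso E n).hom w) := fun w =>
    congrArg (fun ψ : groupCohomology ((invariantsQuotFunctor ℤ
        (E.openNormalSubgroup : Subgroup (absoluteGaloisGroup K))).obj (ideleClassLimitShortComplex K).X₂) n ⟶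
        groupCohomology ((classData K).obj E) n => ψ.hom w)
      (functor_map_ideleToClass_comp_layerCohomologyIso (F := K) E n)
  exact (congrArg (fun w => (layerCohomologyIso E n).hom w) e1).trans (e2 _)

end IdeleClassBar

open IdeleClassBar

namespace FreePresentation

variable {K : Type} [Field K] [NumberField K]
variable {M : Type} [AddCommGroup M] [TopologicalSpace M] [DiscreteTopology M] [Finite M]
  (ρ : DiscreteGaloisModule K M)
variable [CompactSpace (absoluteGaloisGroup K)] [TotallyDisconnectedSpace (absoluteGaloisGroup K)]

/-- **`classBarInv K (Inf_E c ∘ ∂_{C̄}(f ≫ g)) = inv_{E/K}((classRepHom)_* (iso^J_E ((f^{U_E})_* (δ_{S^{U_E}} c))))`** for the canonical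
presentation `S = presentationComplex ρ`, a layer `E ⊇ K(M)`, `c ∈ H¹(Γ_K ⧸ U_E, M^{U_E})` and `f : N₁ → J̄`: the E-side value is
`inv_{E/K}` of the class-map image of the idèle cohomology class `β = iso^J_E ((f^{U_E})_* δ c) ∈ H²(Gal(E/K), J_E)`.
[cite: CasselsFrohlichANT1967, Ch. VII §11.2 (bis)][cite: MilneADT2006, I §4, proof of Theorem 4.10] -/
theorem classBarInv_inflG_comp_boundary_presentation_idele {E : GalLayer K} (h : presentationLayer ρ ≤ E)
    (c : groupCohomology ((invariantsQuotFunctor ℤ (E.openNormalSubgroup : Subgroup (absoluteGaloisGroup K))).obj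
      (presentationComplex ρ).X₃) 1)
    (f : (presentationComplex ρ).X₁ ⟶ (ideleClassLimitShortComplex K).X₂) :
    classBarInv K ((LayerColimit.inflG E.openNormalSubgroup (presentationComplex ρ).X₃ 1 c).comp
        (ExtPresentation.boundary (presentationComplex_shortExact ρ) (classBarD K)
          (f ≫ (ideleClassLimitShortComplex K).g)) (rfl : 1 + 1 = 2)) =
      (haveI := E.numberField; haveI := E.isGalois;
        IdeleCohomology.classInvAll K E.1
          ((groupCohomology.map (MonoidHom.id _) (IdeleClassGroup.classRepHom K E.1) 2).hom
            (((ideleData K).layerCohomologyIso E 2).hom ((groupCohomology.map (MonoidHom.id _)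
              ((invariantsQuotFunctor ℤ (E.openNormalSubgroup : Subgroup (absoluteGaloisGroup K))).map f) 2).hom
              ((groupCohomology.δ (presentationComplex_map_invariantsQuotFunctor_shortExact ρ h) 1 2 rfl).hom c))))) :=
  (classBarInv_inflG_comp_boundary_presentation ρ h c f).trans
    (congrArg _ (layerCohomologyIso_hom_map_comp_ideleToClass E f 2 _))

/-- **For EVERY `ŷ ∈ Ext¹_{C_Γ}(ℤ, M)` and `f : N₁ → J̄`**: a layer `E ⊇ K(M)` and `c` with `ŷ = Inf_E c` and the idèle-layer value
formula of `classBarInv_inflG_comp_boundary_presentation_idele`. [cite: CasselsFrohlichANT1967, Ch. VII §11.2 (bis)]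
[cite: MilneADT2006, I §4, proof of Theorem 4.10] -/
theorem exists_layer_classBarInv_comp_boundary_eq_idele
    (ŷ : Ext (triv (k := ℤ) (Γ := absoluteGaloisGroup K) ℤ) (presentationComplex ρ).X₃ 1)
    (f : (presentationComplex ρ).X₁ ⟶ (ideleClassLimitShortComplex K).X₂) :
    ∃ (E : GalLayer K) (h : presentationLayer ρ ≤ E) (c : groupCohomology
      ((invariantsQuotFunctor ℤ (E.openNormalSubgroup : Subgroup (absoluteGaloisGroup K))).obj
        (presentationComplex ρ).X₃) 1),
      LayerColimit.inflG E.openNormalSubgroup (presentationComplex ρ).X₃ 1 c = ŷ ∧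
      classBarInv K (ŷ.comp (ExtPresentation.boundary (presentationComplex_shortExact ρ) (classBarD K)
          (f ≫ (ideleClassLimitShortComplex K).g)) (rfl : 1 + 1 = 2)) =
        (haveI := E.numberField; haveI := E.isGalois;
          IdeleCohomology.classInvAll K E.1
            ((groupCohomology.map (MonoidHom.id _) (IdeleClassGroup.classRepHom K E.1) 2).hom
              (((ideleData K).layerCohomologyIso E 2).hom ((groupCohomology.map (MonoidHom.id _)
                ((invariantsQuotFunctor ℤ (E.openNormalSubgroup : Subgroup (absoluteGaloisGroup K))).map f) 2).hom
                ((groupCohomology.δ (presentationComplex_map_invariantsQuotFunctor_shortExact ρ h) 1 2 rfl).hom c))))) := by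
  obtain ⟨E, h, c, rfl⟩ := exists_layer_ge_inflG_eq (presentationLayer ρ) (presentationComplex ρ).X₃ 1 ŷ
  exact ⟨E, h, c, rfl, classBarInv_inflG_comp_boundary_presentation_idele ρ h c f⟩

end FreePresentation

end Literature.NumberTheory.GaloisRepresentations

end
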